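import Summits.ResolutionOfSingularities.ResolutionOfSingularities.Theorems.FrobeniusClosingPatchingRelPerfectDepthConeVertexCharts
import Literature.AlgebraicGeometry.Resolution.MarkedIdealsEtale
import Literature.AlgebraicGeometry.Resolution.KollarOrderReduction
import Literature.AlgebraicGeometry.Hironaka2017.Lib.SingPolynomial
import Literature.AlgebraicGeometry.Motives.ProjectiveSpaceHyperplaneMultiplicity
import HarnessLib

/-!
# Crux `PatchingRelPerfect` (stmt-ResolutionOfSingularities-16161), chain W5.2 — TargetsF4 §5 E-side
# `ConeVertexResolvable ℓ`: the weight-`ℓ` controlled transform of a cone under the blowing up of its vertex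
# IS the pull-back of the base hypersurface along de Jong's projection

[OURS · L1 W5.2 · TargetsF4 §5 support; res-L1-w52-plan-1 STEER 06:34:44Z (B), split with res-type-003 07:11:12Z]
Pure PROOFS (no definitions, no named facts). For a field `κ₀`, a form `F ∈ κ₀[y₀, …, y_m]` of degree `ℓ`, its cone
`G = F(x₀, …, x_m) ∈ κ₀[x₀, …, x_{m+1}]`, ANY blowing up `b : P̃ → ℙ^{m+1}_{κ₀}` of the reduced vertex
`v = (0 : … : 0 : 1)` (`IsBlowup b (DeJong1996.vertexIdealSheaf m κ₀)`) and de Jong's projection from the vertex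
`q : P̃ → ℙ^m_{κ₀}` (`DeJong1996.vertexBlowupProjection b hb`, a SMOOTH morphism: `DeJong1996.smooth_vertexBlowupProjection`):

* **`controlledTransform_cone_eq_comap_vertexBlowupProjection` (★)** — `(b^*(G)~ : 𝓘_E^ℓ) = q^*(F)~` as ideal
  sheaves on `P̃` (`controlledTransform b 𝓘_v (G)~ ℓ = ((F)~).comap q`). Proof: inequalities of ideal sheaves are
  local for covers by open immersions (`S02Preliminaries.le_of_forall_comap_le`); on the charts
  `Spec κ₀[X][I/Xᵢ] → P̃` over `D₊(x_{m+1})` both sides are `(F(X/Xᵢ))~` (`comap_vertexChart_controlledTransform_cone`: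
  `F(X) = Xᵢ^ℓ · F(X/Xᵢ)`, `Xᵢ` a non-zero-divisor, colon sheaves commute with flat pull-back, and `q` is
  `y_a/y_i ↦ X_a/Xᵢ` there, `DeJong1996.vertexChart_comp_vertexBlowupProjection`); on `P̃ ×_{ℙ^{m+1}} D₊(x_j)`,
  `j ≤ m`, the centre is the unit ideal and `q = pr_v ∘ b` with `pr_v^*(F / y_j^ℓ) = G / x_j^ℓ`
  (`comap_pullbackFst_controlledTransform_cone`, `DeJong1996.isVertexProjection_vertexBlowupProjection`);
* `idealOrder_controlledTransform_cone_eq` — `ord_x (b^*(G)~ : 𝓘_E^ℓ) = ord_{q x} (F)~` at EVERY `x ∈ P̃`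
  (`Hironaka2017.idealOrder_comap_eq_of_smooth`); hence **`idealOrder_controlledTransform_cone_le_one`**: if `V₊(F) ⊂ ℙ^m`
  has order `≤ 1` everywhere, so has the transform — over the vertex AND off it, with no separate cylinder argument;
* **`isLocallyPrincipal_controlledTransform_cone`** — the transform is locally principal as soon as `(F)~` is
  (`IsLocallyPrincipal.comap`; `(F)~` is locally principal by res-type-003's `…DepthSingleFormBasics`).

Together with `projIdealSheaf_cone_le_vertexIdealSheaf_pow` (`…DepthConeVertexCharts`), the tree's
`isRegular_subscheme_vanishingIdeal_singleton`, `exists_isBlowup`, `IsBlowup.pow_mul_controlledTransform_eq`,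
`DeJong1996.isIntegral_of_isBlowup_vertex` / `isDominant_of_isBlowup_vertex` / `vertexIdealSheaf_ne_bot`, these are
the inputs of the ONE pure weight-`ℓ` step `DepthTargets.IsPureWeightedSeq.cons` proving F4's
`DepthTargets.ConeVertexResolvable ℓ` for every `ℓ` (assembly: res-type-003). The ideal sheaves are spelled
`projIdealSheaf _ ⟨Ideal.span (Set.range fun _ : Fin 1 => ·), _⟩`, which is F4's `DepthTargets.formsIdealSheaf`
unfolded (`rfl`). AI-written; AI review is weaker than expert review. Nothing here is a statement of the manuscript
under review.

## References
* A. J. de Jong, *Smoothness, semi-stability and alterations*, Publ. Math. IHÉS 83 (1996), proof of Lemma 4.11,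
  p. 68 (the blowing up of `ℙ^{d+1}` in a point and its projection, a `ℙ¹`-bundle). [DeJong1996]
* R. Hartshorne, *Algebraic Geometry* (1977), II Thm. 8.24 (b), II Prop. 5.11 (b). [Hartshorne1977]
* E. Bierstone, D. Grigoriev, P. Milman, J. Włodarczyk (2011), Def. 3.1.3, §3.2 (controlled transform).
  [BierstoneGrigorievMilmanWlodarczyk2011]
* J. Kollár, *Lectures on Resolution of Singularities* (2007), 3.30.2. [Kollar2007]
-/

-- `Summit.<Summit>.<Sub>.Theorems` with `Sub = Summit` (single-conjunct summit, D-0017)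
set_option linter.dupNamespace false

noncomputable section

open CategoryTheory CategoryTheory.Limits AlgebraicGeometry TopologicalSpace HomogeneousLocalization
open Literature.AlgebraicGeometry.Resolution Literature.AlgebraicGeometry.Motives
open Literature.AlgebraicGeometry.Hironaka2017

attribute [local instance] MvPolynomial.gradedAlgebra

namespace Summit.ResolutionOfSingularities.ResolutionOfSingularities.Theorems.DepthCone

universe u

open Literature.AlgebraicGeometry.Motives.Segre (grading chartι X_mem frac cst)
open DeJong1996

variable (κ₀ : Type u) [Field κ₀] (m ℓ : ℕ)

/-! ## The two families of charts -/

/-- **The cone over the vertex, chart by chart**: on the chart `Spec Cᵢ → P̃` over `D₊(x_{m+1})` the weight-`ℓ`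
controlled transform of the cone `(G)~`, `G = F(x₀, …, x_m)`, and the pull-back of `(F)~` along the projection
`q : P̃ → ℙ^m` are the same ideal sheaf, namely `(F(X/Xᵢ))~`: `F(X) = Xᵢ^ℓ · F(X/Xᵢ)` with `Xᵢ` the (non-zero-divisor)
equation of the exceptional divisor, and `q` is `y_a/yᵢ ↦ X_a/Xᵢ` on the chart. [folklore] -/
theorem comap_vertexChart_controlledTransform_cone (i : Fin (m + 1)) (F : MvPolynomial (Fin (m + 1)) κ₀)
    (hF : F ∈ MvPolynomial.homogeneousSubmodule (Fin (m + 1)) κ₀ ℓ)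
    (hG : MvPolynomial.rename Fin.castSucc F ∈ MvPolynomial.homogeneousSubmodule (Fin (m + 1 + 1)) κ₀ ℓ)
    {P : Scheme.{u}} {b : P ⟶ ProjSpace.P (m + 1) κ₀} [IsIntegral P] [IsDominant b]
    (hb : IsBlowup b (vertexIdealSheaf m κ₀)) :
    (controlledTransform b (vertexIdealSheaf m κ₀)
        (projIdealSheaf (MvPolynomial.homogeneousSubmodule (Fin (m + 1 + 1)) κ₀)
          ⟨Ideal.span (Set.range fun _ : Fin 1 => MvPolynomial.rename Fin.castSucc F),
            isHomogeneous_span_of_forall_mem _ _ (fun _ => ℓ) fun _ => hG⟩) ℓ).comap (vertexChart hb i) =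
      ((projIdealSheaf (MvPolynomial.homogeneousSubmodule (Fin (m + 1)) κ₀)
          ⟨Ideal.span (Set.range fun _ : Fin 1 => F),
            isHomogeneous_span_of_forall_mem _ _ (fun _ => ℓ) fun _ => hF⟩).comap
        (vertexBlowupProjection b hb)).comap (vertexChart hb i) := by
  haveI : IsProper b := hb.isProper
  haveI : IsLocallyNoetherian P := LocallyOfFiniteType.isLocallyNoetherian b
  haveI : IsLocallyNoetherian (Spec (CommRingCat.of (PointBlowup.Chart m κ₀ i))) :=
    isLocallyNoetherian_of_isOpenImmersion (vertexChart hb i)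
  -- the right-hand side: `q` on the chart is `Spec (y_a/yᵢ ↦ X_a/Xᵢ)` followed by `D₊(yᵢ) ↪ ℙ^m`
  rw [← Scheme.IdealSheafData.comap_comp, vertexChart_comp_vertexBlowupProjection,
    Scheme.IdealSheafData.comap_comp, comap_awayι_projIdealSheaf_span _ _ (fun _ => ℓ) (fun _ => hF),
    comap_idealSheaf_specMap, Ideal.map_span, ← Set.range_comp]
  -- the left-hand side: colon ideal sheaves commute with the flat chart map; then read everything on
  -- `Spec Cᵢ` through `Γ(D₊(x_{m+1})) ≅ k[X₀, …, X_m]`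
  rw [controlledTransform, comap_colon_of_flat, ← comap_pow, ← Scheme.IdealSheafData.comap_comp,
    ← Scheme.IdealSheafData.comap_comp, vertexChart_comp hb i, Scheme.IdealSheafData.comap_comp,
    Scheme.IdealSheafData.comap_comp, comap_fromSpec, comap_fromSpec, comap_idealSheaf_specMap,
    comap_idealSheaf_specMap]
  have hG' : (projIdealSheaf (MvPolynomial.homogeneousSubmodule (Fin (m + 1 + 1)) κ₀)
        ⟨Ideal.span (Set.range fun _ : Fin 1 => MvPolynomial.rename Fin.castSucc F),
          isHomogeneous_span_of_forall_mem _ _ (fun _ => ℓ) fun _ => hG⟩).ideal (lastChart m κ₀) =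
      Ideal.span (Set.range fun _ : Fin 1 => (Proj.awayToSection _ (MvPolynomial.X (Fin.last (m + 1)))).hom
        (mk₁ _ (X_mem κ₀ (Fin.last (m + 1))) ℓ (MvPolynomial.rename Fin.castSucc F) hG)) :=
    projIdealSheaf_ideal_basicOpen_span _ _ (fun _ => ℓ) (fun _ => hG) _ (X_mem κ₀ (Fin.last (m + 1)))
  have hC' : ((vertexIdealSheaf m κ₀ ^ ℓ).ideal (lastChart m κ₀)).map (toChart m κ₀ i) =
      Ideal.span {PointBlowup.exc m κ₀ i ^ ℓ} := by
    rw [Scheme.IdealSheafData.ideal_pow, Pi.pow_apply, Ideal.map_pow, toChart, ← Ideal.map_map,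
      map_vanishingIdeal_vertex_ideal_lastChart, PointBlowup.map_originIdeal_eq_span, Ideal.span_singleton_pow]
  have hGm : toChart m κ₀ i ((Proj.awayToSection _ (MvPolynomial.X (Fin.last (m + 1)))).hom
        (mk₁ _ (X_mem κ₀ (Fin.last (m + 1))) ℓ (MvPolynomial.rename Fin.castSucc F) hG)) =
      algebraMap (PointBlowup.R m κ₀) (PointBlowup.Chart m κ₀ i) F := by
    rw [toChart, RingHom.comp_apply, RingEquiv.toRingHom_eq_coe, RingEquiv.coe_toRingHom,
      lastChartEquiv_awayToSection_mk₁]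
  rw [hG', hC', Ideal.map_span, ← Set.range_comp]
  have h1 : (⇑(toChart m κ₀ i) ∘ fun _ : Fin 1 => (Proj.awayToSection _ (MvPolynomial.X (Fin.last (m + 1)))).hom
        (mk₁ _ (X_mem κ₀ (Fin.last (m + 1))) ℓ (MvPolynomial.rename Fin.castSucc F) hG)) =
      fun _ : Fin 1 => PointBlowup.exc m κ₀ i ^ ℓ * PointBlowup.projRingHom m κ₀ i
        (mk₁ (grading (Fin (m + 1)) κ₀) (X_mem κ₀ i) ℓ F hF) := by
    funext l
    rw [Function.comp_apply, hGm, algebraMap_eq_exc_pow_mul_projRingHom_mk₁]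
  have h2 : (⇑(PointBlowup.projRingHom m κ₀ i) ∘ fun _ : Fin 1 =>
        mk₁ (MvPolynomial.homogeneousSubmodule (Fin (m + 1)) κ₀) (X_mem κ₀ i) ℓ F hF) =
      fun _ : Fin 1 => PointBlowup.projRingHom m κ₀ i (mk₁ (grading (Fin (m + 1)) κ₀) (X_mem κ₀ i) ℓ F hF) := by
    funext l
    rfl
  rw [h1, h2, Set.range_const, Set.range_const]
  exact colon_idealSheaf_span_mul (pow_mem (PointBlowup.exc_mem_nonZeroDivisors m κ₀ i) ℓ) _

/-- **The cone off the vertex, chart by chart**: on `P̃ ×_{ℙ^{m+1}} D₊(x_j) → P̃`, `j ≤ m`, the centre is the unit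
ideal, so the controlled transform of `(G)~` is its total transform, the pull-back of `(G / x_j^ℓ)~` from
`D₊(x_j)`; and `q = pr_v ∘ b` there, with `pr_v^*(F / y_j^ℓ) = G / x_j^ℓ`. [folklore] -/
theorem comap_pullbackFst_controlledTransform_cone (j : Fin (m + 1)) (F : MvPolynomial (Fin (m + 1)) κ₀)
    (hF : F ∈ MvPolynomial.homogeneousSubmodule (Fin (m + 1)) κ₀ ℓ)
    (hG : MvPolynomial.rename Fin.castSucc F ∈ MvPolynomial.homogeneousSubmodule (Fin (m + 1 + 1)) κ₀ ℓ)
    {P : Scheme.{u}} {b : P ⟶ ProjSpace.P (m + 1) κ₀} [IsIntegral P] [IsDominant b]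
    (hb : IsBlowup b (vertexIdealSheaf m κ₀)) :
    (controlledTransform b (vertexIdealSheaf m κ₀)
        (projIdealSheaf (MvPolynomial.homogeneousSubmodule (Fin (m + 1 + 1)) κ₀)
          ⟨Ideal.span (Set.range fun _ : Fin 1 => MvPolynomial.rename Fin.castSucc F),
            isHomogeneous_span_of_forall_mem _ _ (fun _ => ℓ) fun _ => hG⟩) ℓ).comap
        (pullback.fst b (chartι κ₀ (Fin.castSucc j))) =
      ((projIdealSheaf (MvPolynomial.homogeneousSubmodule (Fin (m + 1)) κ₀)
          ⟨Ideal.span (Set.range fun _ : Fin 1 => F),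
            isHomogeneous_span_of_forall_mem _ _ (fun _ => ℓ) fun _ => hF⟩).comap
        (vertexBlowupProjection b hb)).comap (pullback.fst b (chartι κ₀ (Fin.castSucc j))) := by
  haveI : IsProper b := hb.isProper
  haveI : IsLocallyNoetherian P := LocallyOfFiniteType.isLocallyNoetherian b
  haveI : IsLocallyNoetherian (pullback b (chartι κ₀ (Fin.castSucc j))) :=
    isLocallyNoetherian_of_isOpenImmersion (pullback.fst b (chartι κ₀ (Fin.castSucc j)))
  -- the right-hand side: `q = pr_v ∘ b` over `D₊(x_j)`
  have hq : pullback.fst b (chartι κ₀ (Fin.castSucc j)) ≫ vertexBlowupProjection b hb =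
      pullback.snd b (chartι κ₀ (Fin.castSucc j)) ≫ vertexProjectionChart m κ₀ j :=
    (isVertexProjection_vertexBlowupProjection b hb).pullback_fst_comp j
  rw [← Scheme.IdealSheafData.comap_comp, hq, vertexProjectionChart, Scheme.IdealSheafData.comap_comp,
    Scheme.IdealSheafData.comap_comp, comap_awayι_projIdealSheaf_span _ _ (fun _ => ℓ) (fun _ => hF),
    comap_idealSheaf_specMap, Ideal.map_span, ← Set.range_comp]
  -- the left-hand side: the centre pulls back to the unit ideal
  rw [controlledTransform, comap_colon_of_flat, ← comap_pow, ← Scheme.IdealSheafData.comap_comp,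
    ← Scheme.IdealSheafData.comap_comp, pullback.condition, Scheme.IdealSheafData.comap_comp,
    Scheme.IdealSheafData.comap_comp, comap_pow, comap_chartι_vertexIdealSheaf,
    ← Scheme.IdealSheafData.one_eq_top, one_pow, Scheme.IdealSheafData.one_eq_top,
    Scheme.IdealSheafData.comap_top, colon_top,
    comap_awayι_projIdealSheaf_span _ _ (fun _ => ℓ) (fun _ => hG)]
  have h1 : (⇑(vertexProjectionRingHom m κ₀ j) ∘ fun _ : Fin 1 =>
        mk₁ (MvPolynomial.homogeneousSubmodule (Fin (m + 1)) κ₀) (X_mem κ₀ j) ℓ F hF) =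
      fun _ : Fin 1 => mk₁ (grading (Fin (m + 1 + 1)) κ₀) (X_mem κ₀ (Fin.castSucc j)) ℓ
        (MvPolynomial.rename Fin.castSucc F) hG := by
    funext l
    exact vertexProjectionRingHom_mk₁ κ₀ m ℓ j F hF hG
  rw [h1]

/-! ## The transform identity and its corollaries -/

/-- **The weight-`ℓ` controlled transform of the cone under the blowing up of the vertex is the pull-back of
the base hypersurface along the projection.** For a form `F` of degree `ℓ` in `x₀, …, x_m` over a field `κ₀`,
its cone `G = F(x₀, …, x_m) ∈ κ₀[x₀, …, x_{m+1}]`, ANY blowing up `b : P̃ → ℙ^{m+1}_{κ₀}` of the (reduced)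
vertex `v = (0 : … : 0 : 1)` and de Jong's projection `q : P̃ → ℙ^m_{κ₀}` from the vertex
(`DeJong1996.vertexBlowupProjection`, a smooth `ℙ¹`-bundle): `(b^*(G)~ : 𝓘_E^ℓ) = q^*(F)~` as ideal sheaves on
`P̃`. Proof: both sides are computed on the charts `Spec κ₀[X][I/Xᵢ]` over `D₊(x_{m+1})`
(`comap_vertexChart_controlledTransform_cone`) and on `P̃ ×_{ℙ^{m+1}} D₊(x_j)`, `j ≤ m`
(`comap_pullbackFst_controlledTransform_cone`), which jointly cover `P̃`; inequalities of ideal sheaves are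
local for covers by open immersions. [cite: DeJong1996, Lemma 4.11 (proof), p. 68]
[cite: Hartshorne1977, II Thm. 8.24 (b)] -/
theorem controlledTransform_cone_eq_comap_vertexBlowupProjection
    (F : MvPolynomial (Fin (m + 1)) κ₀) (hF : F ∈ MvPolynomial.homogeneousSubmodule (Fin (m + 1)) κ₀ ℓ)
    {G : MvPolynomial (Fin (m + 1 + 1)) κ₀} (hG : G ∈ MvPolynomial.homogeneousSubmodule (Fin (m + 1 + 1)) κ₀ ℓ)
    (hGF : G = MvPolynomial.rename Fin.castSucc F)
    {P : Scheme.{u}} {b : P ⟶ ProjSpace.P (m + 1) κ₀} [IsIntegral P] [IsDominant b]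
    (hb : IsBlowup b (vertexIdealSheaf m κ₀)) :
    controlledTransform b (vertexIdealSheaf m κ₀)
        (projIdealSheaf (MvPolynomial.homogeneousSubmodule (Fin (m + 1 + 1)) κ₀)
          ⟨Ideal.span (Set.range fun _ : Fin 1 => G),
            isHomogeneous_span_of_forall_mem _ _ (fun _ => ℓ) fun _ => hG⟩) ℓ =
      (projIdealSheaf (MvPolynomial.homogeneousSubmodule (Fin (m + 1)) κ₀)
          ⟨Ideal.span (Set.range fun _ : Fin 1 => F),
            isHomogeneous_span_of_forall_mem _ _ (fun _ => ℓ) fun _ => hF⟩).comap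
        (vertexBlowupProjection b hb) := by
  subst hGF
  -- the joint cover of `P̃` by the charts over the vertex and the pieces over `D₊(x_j)`, `j ≤ m`
  let Y : Fin (m + 1) ⊕ Fin (m + 1) → Scheme.{u} :=
    Sum.elim (fun i => Spec (CommRingCat.of (PointBlowup.Chart m κ₀ i)))
      (fun j => pullback b (chartι κ₀ (Fin.castSucc j)))
  let g : ∀ k, Y k ⟶ P := fun k =>
    match k with
    | Sum.inl i => vertexChart hb i
    | Sum.inr j => pullback.fst b (chartι κ₀ (Fin.castSucc j))
  haveI hg : ∀ k, IsOpenImmersion (g k) := fun k =>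
    match k with
    | Sum.inl i => inferInstanceAs (IsOpenImmersion (vertexChart hb i))
    | Sum.inr j => inferInstanceAs (IsOpenImmersion (pullback.fst b (chartι κ₀ (Fin.castSucc j))))
  have hcov : ∀ x : P, ∃ k ∈ (Set.univ : Set (Fin (m + 1) ⊕ Fin (m + 1))), x ∈ Set.range (g k) := by
    intro x
    rcases mem_range_fst_or_mem_range_vertexChart κ₀ m hb x with ⟨j, hj⟩ | ⟨i, hi⟩
    · exact ⟨Sum.inr j, Set.mem_univ _, hj⟩
    · exact ⟨Sum.inl i, Set.mem_univ _, hi⟩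
  have key : ∀ k, (controlledTransform b (vertexIdealSheaf m κ₀)
        (projIdealSheaf (MvPolynomial.homogeneousSubmodule (Fin (m + 1 + 1)) κ₀)
          ⟨Ideal.span (Set.range fun _ : Fin 1 => MvPolynomial.rename Fin.castSucc F),
            isHomogeneous_span_of_forall_mem _ _ (fun _ => ℓ) fun _ => hG⟩) ℓ).comap (g k) =
      ((projIdealSheaf (MvPolynomial.homogeneousSubmodule (Fin (m + 1)) κ₀)
          ⟨Ideal.span (Set.range fun _ : Fin 1 => F),
            isHomogeneous_span_of_forall_mem _ _ (fun _ => ℓ) fun _ => hF⟩).comap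
        (vertexBlowupProjection b hb)).comap (g k) := fun k =>
    match k with
    | Sum.inl i => comap_vertexChart_controlledTransform_cone κ₀ m ℓ i F hF hG hb
    | Sum.inr j => comap_pullbackFst_controlledTransform_cone κ₀ m ℓ j F hF hG hb
  exact le_antisymm
    (S02Preliminaries.le_of_forall_comap_le Set.univ g hcov fun k _ => (key k).le)
    (S02Preliminaries.le_of_forall_comap_le Set.univ g hcov fun k _ => (key k).ge)

/-- **`ord_x (b^*(G)~ : 𝓘_E^ℓ) = ord_{q x} (F)~` at every point of the blow-up** — the projection `q` is smooth
(`DeJong1996.smooth_vertexBlowupProjection`) and orders of ideals are invariant under smooth pull-back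
(`Hironaka2017.idealOrder_comap_eq_of_smooth`). [cite: DeJong1996, Lemma 4.11 (proof), p. 68] -/
theorem idealOrder_controlledTransform_cone_eq
    (F : MvPolynomial (Fin (m + 1)) κ₀) (hF : F ∈ MvPolynomial.homogeneousSubmodule (Fin (m + 1)) κ₀ ℓ)
    {G : MvPolynomial (Fin (m + 1 + 1)) κ₀} (hG : G ∈ MvPolynomial.homogeneousSubmodule (Fin (m + 1 + 1)) κ₀ ℓ)
    (hGF : G = MvPolynomial.rename Fin.castSucc F)
    {P : Scheme.{u}} {b : P ⟶ ProjSpace.P (m + 1) κ₀} [IsIntegral P] [IsDominant b]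
    (hb : IsBlowup b (vertexIdealSheaf m κ₀)) (x : P) :
    idealOrder (controlledTransform b (vertexIdealSheaf m κ₀)
        (projIdealSheaf (MvPolynomial.homogeneousSubmodule (Fin (m + 1 + 1)) κ₀)
          ⟨Ideal.span (Set.range fun _ : Fin 1 => G),
            isHomogeneous_span_of_forall_mem _ _ (fun _ => ℓ) fun _ => hG⟩) ℓ) x =
      idealOrder (projIdealSheaf (MvPolynomial.homogeneousSubmodule (Fin (m + 1)) κ₀)
          ⟨Ideal.span (Set.range fun _ : Fin 1 => F),
            isHomogeneous_span_of_forall_mem _ _ (fun _ => ℓ) fun _ => hF⟩)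
        (vertexBlowupProjection b hb x) := by
  rw [controlledTransform_cone_eq_comap_vertexBlowupProjection κ₀ m ℓ F hF hG hGF hb]
  haveI := smooth_vertexBlowupProjection b hb
  exact idealOrder_comap_eq_of_smooth _ _ x

/-- **Order `≤ 1` everywhere**: if the hypersurface `V₊(F) ⊂ ℙ^m_{κ₀}` has order `≤ 1` at every point (it is a
regular divisor), then the weight-`ℓ` controlled transform of its cone under the blowing up of the vertex has order
`≤ 1` at EVERY point of the blow-up — over the vertex and off it alike. [cite: Hartshorne1977, II Thm. 8.24 (b)]
[cite: Kollar2007, 3.30.2] -/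
theorem idealOrder_controlledTransform_cone_le_one
    (F : MvPolynomial (Fin (m + 1)) κ₀) (hF : F ∈ MvPolynomial.homogeneousSubmodule (Fin (m + 1)) κ₀ ℓ)
    (hreg : ∀ e : ProjSpace.P m κ₀, idealOrder (projIdealSheaf (MvPolynomial.homogeneousSubmodule (Fin (m + 1)) κ₀)
          ⟨Ideal.span (Set.range fun _ : Fin 1 => F),
            isHomogeneous_span_of_forall_mem _ _ (fun _ => ℓ) fun _ => hF⟩) e ≤ 1)
    {G : MvPolynomial (Fin (m + 1 + 1)) κ₀} (hG : G ∈ MvPolynomial.homogeneousSubmodule (Fin (m + 1 + 1)) κ₀ ℓ)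
    (hGF : G = MvPolynomial.rename Fin.castSucc F)
    {P : Scheme.{u}} {b : P ⟶ ProjSpace.P (m + 1) κ₀} [IsIntegral P] [IsDominant b]
    (hb : IsBlowup b (vertexIdealSheaf m κ₀)) (x : P) :
    idealOrder (controlledTransform b (vertexIdealSheaf m κ₀)
        (projIdealSheaf (MvPolynomial.homogeneousSubmodule (Fin (m + 1 + 1)) κ₀)
          ⟨Ideal.span (Set.range fun _ : Fin 1 => G),
            isHomogeneous_span_of_forall_mem _ _ (fun _ => ℓ) fun _ => hG⟩) ℓ) x ≤ 1 := by
  rw [idealOrder_controlledTransform_cone_eq κ₀ m ℓ F hF hG hGF hb x]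
  exact hreg _

/-- **Local principality**: the weight-`ℓ` controlled transform of the cone is locally principal as soon as `(F)~`
is (a pull-back of a locally principal ideal sheaf, `IsLocallyPrincipal.comap`). [folklore] -/
theorem isLocallyPrincipal_controlledTransform_cone
    (F : MvPolynomial (Fin (m + 1)) κ₀) (hF : F ∈ MvPolynomial.homogeneousSubmodule (Fin (m + 1)) κ₀ ℓ)
    (hlp : IsLocallyPrincipal (projIdealSheaf (MvPolynomial.homogeneousSubmodule (Fin (m + 1)) κ₀)
          ⟨Ideal.span (Set.range fun _ : Fin 1 => F),
            isHomogeneous_span_of_forall_mem _ _ (fun _ => ℓ) fun _ => hF⟩))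
    {G : MvPolynomial (Fin (m + 1 + 1)) κ₀} (hG : G ∈ MvPolynomial.homogeneousSubmodule (Fin (m + 1 + 1)) κ₀ ℓ)
    (hGF : G = MvPolynomial.rename Fin.castSucc F)
    {P : Scheme.{u}} {b : P ⟶ ProjSpace.P (m + 1) κ₀} [IsIntegral P] [IsDominant b]
    (hb : IsBlowup b (vertexIdealSheaf m κ₀)) :
    IsLocallyPrincipal (controlledTransform b (vertexIdealSheaf m κ₀)
        (projIdealSheaf (MvPolynomial.homogeneousSubmodule (Fin (m + 1 + 1)) κ₀)
          ⟨Ideal.span (Set.range fun _ : Fin 1 => G),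
            isHomogeneous_span_of_forall_mem _ _ (fun _ => ℓ) fun _ => hG⟩) ℓ) := by
  rw [controlledTransform_cone_eq_comap_vertexBlowupProjection κ₀ m ℓ F hF hG hGF hb]
  exact hlp.comap _

end Summit.ResolutionOfSingularities.ResolutionOfSingularities.Theorems.DepthCone

end
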